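import Summits.ValiantsHypothesis.ValiantsHypothesis.Theorems.BarrierLeverChowBenchmarkPairsBlockPeelConfluent

/-!
# Route BarrierLever — item 22038 `ChowBenchmarkPairs`, line `moore-peel`: the BLOCK PEEL, IX-a — the CONFLUENT QUADRUPLE
# CRITERION, part 1: the confluent matrix `C₄^κ(i)` of a block of FOUR tied points, row operations, attached coefficients

Helper file (`--supports stmt-ValiantsHypothesis-22038`; cell valiant-natproofs, rung V4, 𝒟-side benchmark of record, line
`moore_peel`, planner RULING R71(b) «confluent criterion = mechanism of record for the theory lane»; seat val-np-p4 gen 31).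
Closes NO item.

THE IDEA (memo HOME/val-np-p4/g31/memo/MEMO-valnp4-g31.md §2; the triple version is `…BlockPeelConfluentRows` /
`…BlockPeelConfluent`).  Four tied points merging, `Λ = (1, 1+X, 1+2X, 1+3X)`: third differences inside each label class
`{(s,q) : s < 4}` and an explicit integer recombination of the SIX internal pair rows (leading `X`-orders `0,1,2,2,3,4` — the six
pairs of a 4-set impose only five conditions on symmetric polynomials of degree `≤ 3`, so the last pair row starts at order `4`)
make every row divisible by `X^{pos}`; the `X^{pos}`-coefficients form the INTEGER matrix

  `C₄^κ(i)`: rows `κ̃[q,B]·B^m` (`q < i`, `m < 4`) and six pair rows (term by term in `d ⊆ T_B`, weights `κ|B∖d|κ|d|`, `e = B - d`):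
  `1`, `d`, `C(e,2) + 2ed - 5C(d,2)`, `2C(d,2)`, `6C(e,3) + 6C(e,2)d - 12C(d,3)`,
  `15C(e,4) + 18C(e,3)d + 12C(e,2)C(d,2) - 30eC(d,3) - 15C(d,4)`; columns the quadruple window `[c_i, c_{i+4})`

(`confMatrix4`; as functions of `B` the pair rows are `β⁰⁰, β⁰¹, 2β⁰², 2(β¹¹-β⁰²)-…`, i.e. span `β⁰⁰, β⁰¹, β⁰², β¹¹, β¹²-β⁰³, β²²-β¹³`).
THIS FILE: definitions and the attached classes (third differences: `coeff_0 = coeff_1 = coeff_2 = 0`, `coeff_3 = B³`).  The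
companion `…BlockPeelConfluent4` finishes: pair rows, factorisation, `det C₄^κ(i) ≠ 0 ⇒ det J^κ(i,4)(Λ) ≠ 0`, and the
UNRESTRICTED node `Stmt.conjConfluentB4` («`det C₄^{!}(i) ≠ 0` for every `i ≥ 1`») with its arrow to node #1.

EVIDENCE (kit j333264 / j333265, `--workitem 22038`): `C₄^{!}(i)` nonsingular mod 65521 for EVERY `i ≤ 600` (and the hard stages
`723–726, 744–747, 890–892, 957–959, 1147–1149`); scan `601–1500` running at the time of writing (memo §2).  Unlike the triple matrix
(singular at the all-good `i = 384, 746`) no exception is known.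

WHAT THIS IS NOT: nothing is certified here; node #1 stays OPEN; nothing on crux stmt-ValiantsHypothesis-14610 or on `VP` versus `VNP`.
-/

set_option linter.dupNamespace false

namespace Summit.ValiantsHypothesis.ValiantsHypothesis.Theorems.BarrierLever.MoorePeel

open Polynomial Finset

/-! ## 34. The confluent point for four tied points -/

/-- `Λ_s = 1 + s·X`, `s < 4`. -/
noncomputable def confPoint4 : Fin 4 → ℤ[X] := fun s => 1 + C ((s : ℕ) : ℤ) * X

/-- Unfolding at an anonymous constructor. -/
theorem confPoint4_mk (v : ℕ) (h : v < 4) : confPoint4 ⟨v, h⟩ = 1 + C (v : ℤ) * X := rfl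

/-- `coeff_j (1 + sX)^n = s^j C(n,j)`. -/
theorem coeff_confPoint4_pow (s : Fin 4) (n j : ℕ) :
    ((confPoint4 s) ^ n).coeff j = ((s : ℕ) : ℤ) ^ j * (n.choose j : ℤ) :=
  coeff_one_add_C_mul_X_pow _ n j

/-- The first three points are the points of the triple version. -/
theorem confPoint4_zero : confPoint4 0 = 1 := by simp [confPoint4]

/-- `Λ_1` agrees with the triple version. -/
theorem confPoint4_one : confPoint4 1 = confPoint 1 := by simp [confPoint4, confPoint]

/-- `Λ_2` agrees with the triple version. -/
theorem confPoint4_two : confPoint4 2 = confPoint 2 := by simp [confPoint4, confPoint]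

/-- `6·C(n,3) = n(n-1)(n-2)` over `ℤ`. -/
theorem six_mul_choose_three_int (n : ℕ) : (6 : ℤ) * (n.choose 3 : ℤ) = (n : ℤ) * ((n : ℤ) - 1) * ((n : ℤ) - 2) := by
  rcases lt_or_ge n 3 with hn | hn
  · interval_cases n <;> norm_num
  · obtain ⟨m, rfl⟩ : ∃ m, n = m + 3 := ⟨n - 3, by omega⟩
    have h1 := Nat.add_one_mul_choose_eq (m + 2) 2
    have h2 := Nat.add_one_mul_choose_eq (m + 1) 1
    rw [Nat.choose_one_right] at h2
    have h1' : ((m : ℤ) + 3) * ((m + 2).choose 2 : ℤ) = ((m + 3).choose 3 : ℤ) * 3 := by exact_mod_cast h1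
    have h2' : ((m : ℤ) + 2) * ((m : ℤ) + 1) = ((m + 2).choose 2 : ℤ) * 2 := by exact_mod_cast h2
    push_cast
    linear_combination (-2 : ℤ) * h1' - ((m : ℤ) + 3) * h2'

/-! ## 35. The confluent quadruple matrix -/

/-- Position of a block row inside its class: `s` for attached rows; `(s-1) + (q-i)` for the pair rows
(`(1,i) ↦ 0, (2,i) ↦ 1, (2,i+1) ↦ 2, (3,i) ↦ 2, (3,i+1) ↦ 3, (3,i+2) ↦ 4`). -/
def confPos4 (i : ℕ) (ρ : BlockIdx i 4) : ℕ :=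
  if (ρ.2 : ℕ) < i then (ρ.1 : ℕ) else ((ρ.1 : ℕ) - 1) + ((ρ.2 : ℕ) - i)

/-- The slot of a pair row: `(1,i) ↦ 0, (2,i) ↦ 1, (3,i) ↦ 2, (2,i+1) ↦ 3, (3,i+1) ↦ 4, (3,i+2) ↦ 5` (order `p01,p02,p03,p12,p13,p23`). -/
def confSlot4 (i : ℕ) (ρ : BlockIdx i 4) : ℕ :=
  if (ρ.2 : ℕ) = i then (ρ.1 : ℕ) - 1 else if (ρ.2 : ℕ) = i + 1 then (ρ.1 : ℕ) + 1 else 5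

/-- The pair weights `κ|B∖d|·κ|d|` as integers. -/
def pairW (κ : ℕ → ℕ) (B : ℕ) (d : Finset ℕ) : ℤ := ((κ (bits B \ d).card : ℕ) : ℤ) * ((κ d.card : ℕ) : ℤ)

/-- The six pair rows of `C₄`, term by term (`e = bin(T_B∖d)`, `dd = bin d`). -/
def confPairTerm4 (σ : ℕ) (e dd : ℕ) : ℤ :=
  if σ = 0 then 1
  else if σ = 1 then (dd : ℤ)
  else if σ = 2 then (e.choose 2 : ℤ) + 2 * (e : ℤ) * (dd : ℤ) - 5 * (dd.choose 2 : ℤ)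
  else if σ = 3 then 2 * (dd.choose 2 : ℤ)
  else if σ = 4 then 6 * (e.choose 3 : ℤ) + 6 * (e.choose 2 : ℤ) * (dd : ℤ) - 12 * (dd.choose 3 : ℤ)
  else 15 * (e.choose 4 : ℤ) + 18 * (e.choose 3 : ℤ) * (dd : ℤ) + 12 * (e.choose 2 : ℤ) * (dd.choose 2 : ℤ) -
    30 * (e : ℤ) * (dd.choose 3 : ℤ) - 15 * (dd.choose 4 : ℤ)

/-- Pair row `σ` of `C₄` at column code `B`. -/
def confPair4 (κ : ℕ → ℕ) (σ : ℕ) (B : ℕ) : ℤ :=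
  ∑ d ∈ (bits B).powerset, pairW κ B d * confPairTerm4 σ (bin (bits B \ d)) (bin d)

/-- **The entries of the confluent quadruple matrix.** -/
def confEntry4 (κ : ℕ → ℕ) (i : ℕ) (ρ : BlockIdx i 4) (B : ℕ) : ℤ :=
  if (ρ.2 : ℕ) < i then ((kincl κ (ρ.2 : ℕ) B : ℕ) : ℤ) * (B : ℤ) ^ (ρ.1 : ℕ) else confPair4 κ (confSlot4 i ρ) B

/-- **The confluent quadruple matrix `C₄^κ(i)`**: block rows × the quadruple window `[c_i, c_{i+4})`. -/
def confMatrix4 (κ : ℕ → ℕ) (i : ℕ) : Matrix (BlockIdx i 4) (BlockIdx i 4) ℤ :=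
  Matrix.of fun ρ ρ' => confEntry4 κ i ρ (windowStart i + (finSigmaFinEquiv ρ' : ℕ))

/-! ## 36. The row operations -/

/-- The six pair members in slot order `p01, p02, p03, p12, p13, p23`. -/
def confPairMem4 (i : ℕ) : Fin 6 → BlockIdx i 4 :=
  ![⟨1, ⟨i, by simp⟩⟩, ⟨2, ⟨i, by simp⟩⟩, ⟨3, ⟨i, by simp⟩⟩, ⟨2, ⟨i + 1, by simp⟩⟩, ⟨3, ⟨i + 1, by simp⟩⟩,
    ⟨3, ⟨i + 2, by simp⟩⟩]

/-- The attached member `(k, q)` of the class of an attached row. -/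
def confAttMem4 (i : ℕ) (k : Fin 4) (ρ : BlockIdx i 4) (hq : (ρ.2 : ℕ) < i) : BlockIdx i 4 :=
  ⟨k, ⟨ρ.2, by have := k.2; omega⟩⟩

/-- Coefficients of the attached row operations (third differences corrected by lower rows), by position and member. -/
noncomputable def confACoef4 (q pos : ℕ) : Fin 4 → ℤ[X] :=
  if pos = 0 then ![1, 0, 0, 0]
  else if pos = 1 then ![-1 + C (q : ℤ) * X, 1, 0, 0]
  else if pos = 2 then
    ![1 - C ((2 * q + 1 : ℕ) : ℤ) * X + C ((q ^ 2 : ℕ) : ℤ) * X ^ 2, -2 + C ((2 * q + 1 : ℕ) : ℤ) * X, 1, 0]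
  else
    ![-1 + C ((3 * q + 3 : ℕ) : ℤ) * X * (1 - C ((2 * q + 1 : ℕ) : ℤ) * X + C ((q ^ 2 : ℕ) : ℤ) * X ^ 2)
        - C ((3 * q ^ 2 + 6 * q + 2 : ℕ) : ℤ) * X ^ 2 * (-1 + C (q : ℤ) * X) + C ((q * (q + 1) * (q + 2) : ℕ) : ℤ) * X ^ 3,
      3 + C ((3 * q + 3 : ℕ) : ℤ) * X * (-2 + C ((2 * q + 1 : ℕ) : ℤ) * X) - C ((3 * q ^ 2 + 6 * q + 2 : ℕ) : ℤ) * X ^ 2,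
      -3 + C ((3 * q + 3 : ℕ) : ℤ) * X,
      1]

/-- Coefficients of the pair recombination, by slot, over `p01, p02, p03, p12, p13, p23`. -/
def confPCoef4 (σ : ℕ) : Fin 6 → ℤ :=
  if σ = 0 then ![1, 0, 0, 0, 0, 0]
  else if σ = 1 then ![-1, 1, 0, 0, 0, 0]
  else if σ = 2 then ![0, 0, -1, 1, 0, 0]
  else if σ = 3 then ![1, -2, 1, 0, 0, 0]
  else if σ = 4 then ![-1, 2, 0, 0, -2, 1]
  else ![1, -4, 3, 3, -4, 1]

/-- The block matrix at the confluent point, as a function of the column code. -/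
noncomputable def confJ4 (κ : ℕ → ℕ) (i : ℕ) (ρ : BlockIdx i 4) (B : ℕ) : ℤ[X] := blockEntry κ i confPoint4 ρ B

/-- **The reduced rows.** -/
noncomputable def confRed4 (κ : ℕ → ℕ) (i : ℕ) (ρ : BlockIdx i 4) (B : ℕ) : ℤ[X] :=
  if hq : (ρ.2 : ℕ) < i then ∑ k : Fin 4, confACoef4 (ρ.2 : ℕ) (ρ.1 : ℕ) k * confJ4 κ i (confAttMem4 i k ρ hq) B
  else ∑ k : Fin 6, ((confPCoef4 (confSlot4 i ρ) k : ℤ) : ℤ[X]) * confJ4 κ i (confPairMem4 i k) B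

/-! ## 37. The attached classes: third differences -/

/-- The third difference `(1+3X)^n - 3(1+2X)^n + 3(1+X)^n - 1`. -/
noncomputable def thirdDiff (n : ℕ) : ℤ[X] :=
  (confPoint4 3) ^ n - C (3 : ℤ) * (confPoint 2) ^ n + C (3 : ℤ) * (confPoint 1) ^ n - 1

/-- The third attached factor. -/
noncomputable def attFac3 (q n : ℕ) : ℤ[X] :=
  thirdDiff n + C ((3 * q + 3 : ℕ) : ℤ) * (X ^ 1 * attFac2 q n) - C ((3 * q ^ 2 + 6 * q + 2 : ℕ) : ℤ) * (X ^ 2 * attFac1 q n) +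
    C ((q * (q + 1) * (q + 2) : ℕ) : ℤ) * X ^ 3

/-- The third difference has no terms below `X³` and `X³`-coefficient `6C(n,3)`. -/
theorem coeff_thirdDiff (n j : ℕ) :
    (thirdDiff n).coeff j = ((3 : ℤ) ^ j - 3 * 2 ^ j + 3 - if j = 0 then 1 else 0) * (n.choose j : ℤ) := by
  unfold thirdDiff
  rw [coeff_sub, coeff_add, coeff_sub, coeff_C_mul, coeff_C_mul, coeff_confPoint4_pow, coeff_confPoint_pow,
    coeff_confPoint_pow, coeff_one]
  simp only [Fin.val_one, Fin.val_two, Nat.cast_one, Nat.cast_ofNat, one_pow]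
  have h3 : (((3 : Fin 4) : ℕ) : ℤ) = 3 := by norm_num
  rw [h3]
  split_ifs with hj
  · subst hj; simp
  · ring

/-- `attFac3` has no constant term. -/
theorem coeff_attFac3_zero (q n : ℕ) : (attFac3 q n).coeff 0 = 0 := by
  unfold attFac3
  simp only [coeff_add, coeff_sub, coeff_C_mul, coeff_thirdDiff, coeff_X_pow_mul', coeff_X_pow]
  norm_num

/-- `attFac3` has no linear term. -/
theorem coeff_attFac3_one (q n : ℕ) : (attFac3 q n).coeff 1 = 0 := by
  unfold attFac3
  simp only [coeff_add, coeff_sub, coeff_C_mul, coeff_thirdDiff, coeff_X_pow_mul', coeff_X_pow]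
  norm_num [coeff_attFac2_zero]

/-- `attFac3` has no quadratic term. -/
theorem coeff_attFac3_two (q n : ℕ) : (attFac3 q n).coeff 2 = 0 := by
  unfold attFac3
  simp only [coeff_add, coeff_sub, coeff_C_mul, coeff_thirdDiff, coeff_X_pow_mul', coeff_X_pow]
  norm_num [coeff_attFac2_one, coeff_attFac1_zero]

/-- The cubic coefficient of `attFac3 q n` is `(n + q)³`. -/
theorem coeff_attFac3_three (q n : ℕ) : (attFac3 q n).coeff 3 = ((n : ℤ) + q) ^ 3 := by
  unfold attFac3
  simp only [coeff_add, coeff_sub, coeff_C_mul, coeff_thirdDiff, coeff_X_pow_mul', coeff_X_pow]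
  norm_num [coeff_attFac2_two, coeff_attFac1_one]
  have h3 := six_mul_choose_three_int n
  linear_combination h3

section Reduced

variable (κ : ℕ → ℕ) (i : ℕ) (ρ : BlockIdx i 4) (B : ℕ)

/-- Attached members evaluate to `κ̃[q,B]·(1+kX)^{B-q}`. -/
theorem confJ4_confAttMem4 (hq : (ρ.2 : ℕ) < i) (k : Fin 4) :
    confJ4 κ i (confAttMem4 i k ρ hq) B = ((kincl κ (ρ.2 : ℕ) B : ℕ) : ℤ[X]) * (confPoint4 k) ^ (B - (ρ.2 : ℕ)) := by
  unfold confJ4 confAttMem4 blockEntry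
  simp only
  rw [if_pos hq]

/-- For an attached row, `confPos4 = s`. -/
theorem confPos4_of_lt (hq : (ρ.2 : ℕ) < i) : confPos4 i ρ = (ρ.1 : ℕ) := by
  unfold confPos4; rw [if_pos hq]

/-- `s ≤ 3`. -/
theorem fst_le_three : (ρ.1 : ℕ) ≤ 3 := by have := ρ.1.2; omega

/-- The coefficient table at each position. -/
theorem confACoef4_of_eq (q pos : ℕ) :
    (pos = 0 → confACoef4 q pos = ![1, 0, 0, 0]) ∧
    (pos = 1 → confACoef4 q pos = ![-1 + C (q : ℤ) * X, 1, 0, 0]) ∧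
    (pos = 2 → confACoef4 q pos =
      ![1 - C ((2 * q + 1 : ℕ) : ℤ) * X + C ((q ^ 2 : ℕ) : ℤ) * X ^ 2, -2 + C ((2 * q + 1 : ℕ) : ℤ) * X, 1, 0]) ∧
    (pos = 3 → confACoef4 q pos =
      ![-1 + C ((3 * q + 3 : ℕ) : ℤ) * X * (1 - C ((2 * q + 1 : ℕ) : ℤ) * X + C ((q ^ 2 : ℕ) : ℤ) * X ^ 2)
          - C ((3 * q ^ 2 + 6 * q + 2 : ℕ) : ℤ) * X ^ 2 * (-1 + C (q : ℤ) * X) + C ((q * (q + 1) * (q + 2) : ℕ) : ℤ) * X ^ 3,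
        3 + C ((3 * q + 3 : ℕ) : ℤ) * X * (-2 + C ((2 * q + 1 : ℕ) : ℤ) * X) - C ((3 * q ^ 2 + 6 * q + 2 : ℕ) : ℤ) * X ^ 2,
        -3 + C ((3 * q + 3 : ℕ) : ℤ) * X, 1]) := by
  refine ⟨fun h => ?_, fun h => ?_, fun h => ?_, fun h => ?_⟩ <;> subst h <;> rfl

/-- Attached class, position `0`. -/
theorem confRed4_att0 (hq : (ρ.2 : ℕ) < i) (hs : (ρ.1 : ℕ) = 0) :
    confRed4 κ i ρ B = ((kincl κ (ρ.2 : ℕ) B : ℕ) : ℤ[X]) := by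
  unfold confRed4
  rw [dif_pos hq, (confACoef4_of_eq (ρ.2 : ℕ) (ρ.1 : ℕ)).1 hs, Fin.sum_univ_four]
  simp only [Matrix.cons_val_zero, Matrix.cons_val_one, Matrix.head_cons, Matrix.cons_val_two, Matrix.tail_cons,
    Matrix.cons_val_three, zero_mul, add_zero, one_mul, confJ4_confAttMem4 κ i ρ B hq, confPoint4_zero, one_pow, mul_one]

/-- Attached class, position `1`: `κ̃ · attFac1 q (B-q)`. -/
theorem confRed4_att1 (hq : (ρ.2 : ℕ) < i) (hs : (ρ.1 : ℕ) = 1) :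
    confRed4 κ i ρ B = ((kincl κ (ρ.2 : ℕ) B : ℕ) : ℤ[X]) * attFac1 (ρ.2 : ℕ) (B - (ρ.2 : ℕ)) := by
  unfold confRed4 attFac1
  rw [dif_pos hq, (confACoef4_of_eq (ρ.2 : ℕ) (ρ.1 : ℕ)).2.1 hs, Fin.sum_univ_four]
  simp only [Matrix.cons_val_zero, Matrix.cons_val_one, Matrix.head_cons, Matrix.cons_val_two, Matrix.tail_cons,
    Matrix.cons_val_three, zero_mul, add_zero, one_mul, confJ4_confAttMem4 κ i ρ B hq, confPoint4_zero, one_pow, mul_one,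
    confPoint4_one]
  ring

/-- Attached class, position `2`: `κ̃ · attFac2 q (B-q)`. -/
theorem confRed4_att2 (hq : (ρ.2 : ℕ) < i) (hs : (ρ.1 : ℕ) = 2) :
    confRed4 κ i ρ B = ((kincl κ (ρ.2 : ℕ) B : ℕ) : ℤ[X]) * attFac2 (ρ.2 : ℕ) (B - (ρ.2 : ℕ)) := by
  unfold confRed4 attFac2
  rw [dif_pos hq, (confACoef4_of_eq (ρ.2 : ℕ) (ρ.1 : ℕ)).2.2.1 hs, Fin.sum_univ_four]
  simp only [Matrix.cons_val_zero, Matrix.cons_val_one, Matrix.head_cons, Matrix.cons_val_two, Matrix.tail_cons,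
    Matrix.cons_val_three, zero_mul, add_zero, one_mul, confJ4_confAttMem4 κ i ρ B hq, confPoint4_zero, one_pow, mul_one,
    confPoint4_one, confPoint4_two]
  rw [show (C (-2 : ℤ) : ℤ[X]) = -2 by simp]
  ring

/-- Attached class, position `3`: `κ̃ · attFac3 q (B-q)`. -/
theorem confRed4_att3 (hq : (ρ.2 : ℕ) < i) (hs : (ρ.1 : ℕ) = 3) :
    confRed4 κ i ρ B = ((kincl κ (ρ.2 : ℕ) B : ℕ) : ℤ[X]) * attFac3 (ρ.2 : ℕ) (B - (ρ.2 : ℕ)) := by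
  unfold confRed4 attFac3 thirdDiff attFac2 attFac1
  rw [dif_pos hq, (confACoef4_of_eq (ρ.2 : ℕ) (ρ.1 : ℕ)).2.2.2 hs, Fin.sum_univ_four]
  simp only [Matrix.cons_val_zero, Matrix.cons_val_one, Matrix.head_cons, Matrix.cons_val_two, Matrix.tail_cons,
    Matrix.cons_val_three, one_mul, confJ4_confAttMem4 κ i ρ B hq, confPoint4_zero, one_pow, mul_one,
    confPoint4_one, confPoint4_two]
  rw [show (C (-2 : ℤ) : ℤ[X]) = -2 by simp, show (C (3 : ℤ) : ℤ[X]) = 3 by simp]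
  ring

end Reduced

end Summit.ValiantsHypothesis.ValiantsHypothesis.Theorems.BarrierLever.MoorePeel
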